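import Mathlib.AlgebraicGeometry.Morphisms.Separated
import Mathlib.AlgebraicGeometry.Properties
import HarnessLib

/-!
# A morphism that is an open immersion on the charts of a cover of an irreducible source is an open immersion

Let `f : X → Y` be a morphism of schemes, `X` IRREDUCIBLE and separated, `Y` reduced, and let
`(U_i)` be an open cover of `X` such that each restriction `U_i ↪ X → Y` is an open immersion.
Then `f` itself is an open immersion:

* locally `f` is an open immersion, so `f` is open and induces isomorphisms on stalks
  (`isOpenMap_of_forall_isOpenImmersion_ι_comp`, `isIso_stalkMap_of_isOpenImmersion_ι_comp`);
* **injectivity** (`injective_of_forall_isOpenImmersion_ι_comp`): if `f x₁ = f x₂ = y` with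
  `x₁ ∈ U_i`, `x₂ ∈ U_j`, the two local inverses `V → U_i ↪ X`, `V → U_j ↪ X` of `f` on the open
  `V = f(U_i) ∩ f(U_j) ∋ y` agree after composition with the open immersion `U_i ∩ U_j → V`, whose
  image is a NON-EMPTY open of the IRREDUCIBLE `V` (an open of `f(U_i) ≅ U_i`), hence dominant;
  as `V` is reduced and `X` separated, the two inverses agree on `V` (Mathlib
  `AlgebraicGeometry.ext_of_isDominant`), so `x₁ = x₂`;
* `isOpenImmersion_of_iSup_eq_top` — the conclusion, by Mathlib's criterion
  `IsOpenImmersion.of_isIso_stalkMap` (open embedding + stalk isomorphisms).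

Without irreducibility the statement fails (glue two copies of `𝔸¹` to `𝔸¹` along the complement of
the origin: both charts are open immersions, the map is not injective) — irreducibility of `X` is what
makes `U_i ∩ U_j` non-empty and dense where the two inverses must be compared.

Theorems only; Mathlib-only imports.  Generic leaf written for the road-W line of cell
`hodgecm-mathlib` (D-0151; A-p06's (G2b) cut (α): the shears of a glued / maximal birational group
law are open immersions chart by chart), independent of it.

## References

* [GortzWedhorn2020] U. Görtz, T. Wedhorn, *Algebraic Geometry I: Schemes* (2nd ed., 2020):
  Def. 3.40 / Prop. 3.5 (gluing of morphisms, open immersions are local on the source's image),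
  Prop. 9.19 (morphisms from a reduced scheme to a separated scheme agreeing on a dense open are
  equal), §(9.6) Prop. 9.27.
* [Artin1986NeronModels] M. Artin, *Néron models*, in Cornell–Silverman (1986), §2 (the charts
  `V′ ∪ V′_s` of the group-law extension).
-/

universe u v

open CategoryTheory Topology TopologicalSpace

namespace Literature.AlgebraicGeometry.Morphisms

open _root_.AlgebraicGeometry

variable {X Y : Scheme.{u}}

/-! ### Local structure: openness and stalks -/

/-- If `U ↪ X → Y` is an open immersion, `f` induces isomorphisms on the stalks at the points of `U`
(`(U.ι ≫ f)_x = f_x ∘ (U.ι)_x` with both outer maps isomorphisms).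
[cite: GortzWedhorn2020, Def. 3.40 and Prop. 3.5] -/
theorem isIso_stalkMap_of_isOpenImmersion_ι_comp (f : X ⟶ Y) (U : X.Opens)
    [IsOpenImmersion (U.ι ≫ f)] (x : U) : IsIso (f.stalkMap (U.ι x)) := by
  have h : IsIso ((U.ι ≫ f).stalkMap x) := inferInstance
  rw [Scheme.Hom.stalkMap_comp] at h
  exact @IsIso.of_isIso_comp_right _ _ _ _ _ (f.stalkMap (U.ι x)) (U.ι.stalkMap x) _ h

/-- If `f` is an open immersion on each chart of an open cover of `X`, then `f` is an open map
(`f(V) = ⋃ᵢ (U_i ↪ X → Y)(U_i ∩ V)`). [cite: GortzWedhorn2020, Def. 3.40 and Prop. 3.5] -/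
theorem isOpenMap_of_forall_isOpenImmersion_ι_comp (f : X ⟶ Y) {ι : Type v} (U : ι → X.Opens)
    (hU : ⨆ i, U i = ⊤) (h : ∀ i, IsOpenImmersion ((U i).ι ≫ f)) : IsOpenMap f := by
  intro V hV
  have hfV : f '' V = ⋃ i, ((U i).ι ≫ f) '' (((U i).ι) ⁻¹' V) := by
    ext y
    constructor
    · rintro ⟨x, hx, rfl⟩
      have hx' : x ∈ (⨆ i, U i : X.Opens) := by rw [hU]; trivial
      obtain ⟨i, hi⟩ := Opens.mem_iSup.mp hx'
      refine Set.mem_iUnion.mpr ⟨i, ⟨x, hi⟩, ?_, ?_⟩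
      · show (U i).ι ⟨x, hi⟩ ∈ V
        rw [Scheme.Opens.ι_apply]; exact hx
      · rw [Scheme.Hom.comp_apply, Scheme.Opens.ι_apply]
    · intro hy
      obtain ⟨i, z, hz, rfl⟩ := Set.mem_iUnion.mp hy
      exact ⟨(U i).ι z, hz, by rw [Scheme.Hom.comp_apply]⟩
  rw [hfV]
  exact isOpen_iUnion fun i =>
    (h i).base_open.isOpenMap _ (hV.preimage ((U i).ι).continuous)

/-! ### Injectivity on an irreducible source -/

/-- The image `f(U)` of a chart on which `f` is an open immersion is (pre)irreducible when `X` is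
irreducible (an open of an irreducible space is preirreducible, and so is its continuous image).
[cite: GortzWedhorn2020, §(9.6) Remark 9.29] -/
theorem isPreirreducible_range_ι_comp [IrreducibleSpace X] (f : X ⟶ Y) (U : X.Opens) :
    IsPreirreducible (Set.range (U.ι ≫ f)) := by
  have hU : IsPreirreducible (U : Set X) :=
    (PreirreducibleSpace.isPreirreducible_univ (X := X)).open_subset U.2 (Set.subset_univ _)
  have hrange : Set.range (U.ι ≫ f) = f '' (U : Set X) := by
    ext y
    constructor
    · rintro ⟨z, rfl⟩
      exact ⟨U.ι z, by rw [Scheme.Opens.ι_apply]; exact z.2, by rw [Scheme.Hom.comp_apply]⟩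
    · rintro ⟨x, hx, rfl⟩
      exact ⟨⟨x, hx⟩, by rw [Scheme.Hom.comp_apply, Scheme.Opens.ι_apply]⟩
  rw [hrange]
  exact hU.image f f.continuous.continuousOn

/-- **Injectivity.**  Let `X` be irreducible and separated, `Y` reduced, and `f : X → Y` an open
immersion on each chart of an open cover of `X`.  Then `f` is injective: for `f x₁ = f x₂ = y`,
`x₁ ∈ U_i`, `x₂ ∈ U_j`, the local inverses `V → U_i ↪ X` and `V → U_j ↪ X` on
`V = f(U_i) ∩ f(U_j) ∋ y` agree after the dominant open immersion `U_i ∩ U_j → V` (non-empty by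
irreducibility), hence agree (reduced source, separated target: Mathlib `ext_of_isDominant`), and
evaluating at `y` gives `x₁ = x₂`. [cite: GortzWedhorn2020, Prop. 9.19 and §(9.6) Prop. 9.27] -/
theorem injective_of_forall_isOpenImmersion_ι_comp [IrreducibleSpace X] [X.IsSeparated]
    [IsReduced Y] (f : X ⟶ Y) {ι : Type v} (U : ι → X.Opens) (hU : ⨆ i, U i = ⊤)
    (h : ∀ i, IsOpenImmersion ((U i).ι ≫ f)) : Function.Injective f := by
  intro x₁ x₂ hx
  -- charts through `x₁`, `x₂`
  have hx₁' : x₁ ∈ (⨆ i, U i : X.Opens) := by rw [hU]; trivial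
  have hx₂' : x₂ ∈ (⨆ i, U i : X.Opens) := by rw [hU]; trivial
  obtain ⟨i, hi⟩ := Opens.mem_iSup.mp hx₁'
  obtain ⟨j, hj⟩ := Opens.mem_iSup.mp hx₂'
  haveI := h i
  haveI := h j
  set e₁ : ((U i : X.Opens) : Scheme.{u}) ⟶ Y := (U i).ι ≫ f with he₁
  set e₂ : ((U j : X.Opens) : Scheme.{u}) ⟶ Y := (U j).ι ≫ f with he₂
  have he₁x : e₁ ⟨x₁, hi⟩ = f x₁ := by rw [he₁, Scheme.Hom.comp_apply, Scheme.Opens.ι_apply]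
  have he₂x : e₂ ⟨x₂, hj⟩ = f x₂ := by rw [he₂, Scheme.Hom.comp_apply, Scheme.Opens.ι_apply]
  -- the open `V = f(U_i) ∩ f(U_j)` of `Y`, containing `y = f x₁ = f x₂`
  let V : Y.Opens := Scheme.Hom.opensRange e₁ ⊓ Scheme.Hom.opensRange e₂
  have hyV : f x₁ ∈ V := ⟨⟨⟨x₁, hi⟩, he₁x⟩, ⟨⟨x₂, hj⟩, he₂x.trans hx.symm⟩⟩
  have hVr₁ : Set.range (V.ι : (V : Scheme.{u}) ⟶ Y) ⊆ Set.range e₁ := by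
    rw [Scheme.Opens.range_ι]; exact fun y hy => hy.1
  have hVr₂ : Set.range (V.ι : (V : Scheme.{u}) ⟶ Y) ⊆ Set.range e₂ := by
    rw [Scheme.Opens.range_ι]; exact fun y hy => hy.2
  -- the two local inverses `t₁, t₂ : V → X` of `f` on `V`
  let s₁ : (V : Scheme.{u}) ⟶ ((U i : X.Opens) : Scheme.{u}) := IsOpenImmersion.lift e₁ V.ι hVr₁
  let s₂ : (V : Scheme.{u}) ⟶ ((U j : X.Opens) : Scheme.{u}) := IsOpenImmersion.lift e₂ V.ι hVr₂
  have hs₁ : s₁ ≫ e₁ = V.ι := IsOpenImmersion.lift_fac e₁ V.ι hVr₁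
  have hs₂ : s₂ ≫ e₂ = V.ι := IsOpenImmersion.lift_fac e₂ V.ι hVr₂
  let t₁ : (V : Scheme.{u}) ⟶ X := s₁ ≫ (U i).ι
  let t₂ : (V : Scheme.{u}) ⟶ X := s₂ ≫ (U j).ι
  -- the open `W = U_i ∩ U_j` of `X`, non-empty by irreducibility, and `w : W → V`
  let W : X.Opens := U i ⊓ U j
  have hWne : (W : Set X).Nonempty :=
    nonempty_preirreducible_inter (U i).2 (U j).2 ⟨x₁, hi⟩ ⟨x₂, hj⟩
  have hWf : Set.range (W.ι ≫ f) ⊆ Set.range (V.ι : (V : Scheme.{u}) ⟶ Y) := by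
    rintro _ ⟨z, rfl⟩
    rw [Scheme.Opens.range_ι]
    refine ⟨⟨⟨z.1, z.2.1⟩, ?_⟩, ⟨⟨z.1, z.2.2⟩, ?_⟩⟩
    · simp only [he₁, Scheme.Hom.comp_apply, Scheme.Opens.ι_apply]
    · simp only [he₂, Scheme.Hom.comp_apply, Scheme.Opens.ι_apply]
  let w : (W : Scheme.{u}) ⟶ (V : Scheme.{u}) := IsOpenImmersion.lift V.ι (W.ι ≫ f) hWf
  have hw : w ≫ V.ι = W.ι ≫ f := IsOpenImmersion.lift_fac V.ι (W.ι ≫ f) hWf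
  -- `w ≫ t₁ = W.ι = w ≫ t₂`
  have hwt₁ : w ≫ t₁ = W.ι := by
    have h1 : (w ≫ s₁) ≫ e₁ = X.homOfLE (inf_le_left : W ≤ U i) ≫ e₁ := by
      rw [Category.assoc, hs₁, hw, he₁, ← Category.assoc, Scheme.homOfLE_ι]
    rw [cancel_mono] at h1
    change (w ≫ s₁) ≫ (U i).ι = W.ι
    rw [h1, Scheme.homOfLE_ι]
  have hwt₂ : w ≫ t₂ = W.ι := by
    have h2 : (w ≫ s₂) ≫ e₂ = X.homOfLE (inf_le_right : W ≤ U j) ≫ e₂ := by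
      rw [Category.assoc, hs₂, hw, he₂, ← Category.assoc, Scheme.homOfLE_ι]
    rw [cancel_mono] at h2
    change (w ≫ s₂) ≫ (U j).ι = W.ι
    rw [h2, Scheme.homOfLE_ι]
  -- `w` is dominant: its image is a non-empty open of the irreducible `V`
  have hWι : W.ι ≫ f = X.homOfLE (inf_le_left : W ≤ U i) ≫ e₁ := by
    rw [he₁, ← Category.assoc, Scheme.homOfLE_ι]
  haveI : IsOpenImmersion (w ≫ V.ι) := by rw [hw, hWι]; infer_instance
  haveI hwo : IsOpenImmersion w := IsOpenImmersion.of_comp w V.ι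
  have hVirr : IsPreirreducible (V : Set Y) :=
    (isPreirreducible_range_ι_comp f (U i)).open_subset V.2 (fun y hy => hy.1)
  haveI : IsDominant w := by
    refine ⟨dense_iff_inter_open.mpr fun O hO hOne => ?_⟩
    -- `V.ι '' O` and `V.ι '' range w` are non-empty opens of `Y` inside the preirreducible `V`
    have hO' : IsOpen (V.ι '' O) := V.ι.isOpenEmbedding.isOpenMap _ hO
    have hR' : IsOpen (V.ι '' Set.range w) := V.ι.isOpenEmbedding.isOpenMap _ hwo.base_open.isOpen_range
    obtain ⟨z₀, hz₀⟩ := hWne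
    have hRne : (V ∩ (V.ι '' Set.range w) : Set Y).Nonempty := by
      refine ⟨V.ι (w ⟨z₀, hz₀⟩), ?_, ⟨w ⟨z₀, hz₀⟩, ⟨⟨z₀, hz₀⟩, rfl⟩, rfl⟩⟩
      have := Scheme.Opens.range_ι V ▸ Set.mem_range_self (f := (V.ι : (V : Scheme.{u}) ⟶ Y)) (w ⟨z₀, hz₀⟩)
      exact this
    obtain ⟨o, ho⟩ := hOne
    have hOne' : (V ∩ (V.ι '' O) : Set Y).Nonempty :=
      ⟨V.ι o, Scheme.Opens.range_ι V ▸ Set.mem_range_self (f := (V.ι : (V : Scheme.{u}) ⟶ Y)) o, ⟨o, ho, rfl⟩⟩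
    obtain ⟨y, -, ⟨o₁, ho₁, hy₁⟩, ⟨v, hv, hy₂⟩⟩ := hVirr _ _ hO' hR' hOne' hRne
    refine ⟨o₁, ho₁, ?_⟩
    have : o₁ = v := V.ι.isOpenEmbedding.injective (hy₁.trans hy₂.symm)
    rw [this]; exact hv
  -- the inverses agree on `V` (reduced source, separated target, dominant `w`)
  have ht : t₁ = t₂ := ext_of_isDominant w (hwt₁.trans hwt₂.symm)
  -- evaluate at `y`
  have hs₁y : s₁ ⟨f x₁, hyV⟩ = ⟨x₁, hi⟩ := by
    apply e₁.isOpenEmbedding.injective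
    rw [← Scheme.Hom.comp_apply, hs₁, Scheme.Opens.ι_apply, he₁x]
  have hs₂y : s₂ ⟨f x₁, hyV⟩ = ⟨x₂, hj⟩ := by
    apply e₂.isOpenEmbedding.injective
    rw [← Scheme.Hom.comp_apply, hs₂, Scheme.Opens.ι_apply, he₂x]
    exact hx
  have h₁ : t₁ ⟨f x₁, hyV⟩ = x₁ := by
    change ((s₁ ≫ (U i).ι) ⟨f x₁, hyV⟩) = x₁
    rw [Scheme.Hom.comp_apply, hs₁y, Scheme.Opens.ι_apply]
  have h₂ : t₂ ⟨f x₁, hyV⟩ = x₂ := by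
    change ((s₂ ≫ (U j).ι) ⟨f x₁, hyV⟩) = x₂
    rw [Scheme.Hom.comp_apply, hs₂y, Scheme.Opens.ι_apply]
  rw [← h₁, ← h₂, ht]

/-! ### The criterion -/

/-- **A morphism from an irreducible separated scheme to a reduced scheme which is an open immersion
on every chart of an open cover of the source is an open immersion** (open embedding — open,
injective by `injective_of_forall_isOpenImmersion_ι_comp` — with isomorphic stalks; Mathlib
`IsOpenImmersion.of_isIso_stalkMap`).  [Artin1986NeronModels] §2 uses it for the charts `V′`, `V′_s` of
the glued group chunk. [cite: GortzWedhorn2020, Prop. 9.19 and §(9.6) Prop. 9.27] [cite: Artin1986NeronModels, §2] -/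
theorem isOpenImmersion_of_iSup_eq_top [IrreducibleSpace X] [X.IsSeparated] [IsReduced Y]
    (f : X ⟶ Y) {ι : Type v} (U : ι → X.Opens) (hU : ⨆ i, U i = ⊤)
    (h : ∀ i, IsOpenImmersion ((U i).ι ≫ f)) : IsOpenImmersion f := by
  haveI : ∀ x, IsIso (f.stalkMap x) := fun x => by
    have hx' : x ∈ (⨆ i, U i : X.Opens) := by rw [hU]; trivial
    obtain ⟨i, hi⟩ := Opens.mem_iSup.mp hx'
    haveI := h i
    exact isIso_stalkMap_of_isOpenImmersion_ι_comp f (U i) ⟨x, hi⟩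
  exact IsOpenImmersion.of_isIso_stalkMap f
    (IsOpenEmbedding.of_continuous_injective_isOpenMap f.continuous
      (injective_of_forall_isOpenImmersion_ι_comp f U hU h)
      (isOpenMap_of_forall_isOpenImmersion_ι_comp f U hU h))

end Literature.AlgebraicGeometry.Morphisms
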